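/-
Copyright (c) 2026 the pub-hodgecm-mathlib formalisation cell (harness21).  Prover seat hodgecm-mathlib-A-p03 (g26); road «W′ = R1LL-WILD», socket (n1) of B-p14 (g33)'s
(B6-V) census e5b7e346 (12:31Z), 2026-09-01.
-/
import Literature.NumberTheory.Rogawski1990.RankOneUnstableWildDepthSignDictionary   -- ★ p844273 (this seat): `hilbertSymbol_eq_one_of_toPlace_eq_mul_galAdicCompletionMap`; brings the norm dictionary + bilinearity
import HarnessLib

/-!
# (W′)∕(B6-V) socket (n1) — THE NORM READING OF `(y, θ)_v` AT A NON-SPLIT PLACE AND THE NON-NORM-UNIT DICHOTOMY `β ∈ N ∨ β∕u ∈ N`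
# (O'Meara §63B; Labesse 2024 Prop. 0.0.11 «κ(c₂) = κ(det x̃)κ(b)»; LL79 §2)

Topic `NumberTheory/Rogawski1990`; namespace `Literature.NumberTheory.Rogawski1990`.  THEOREMS ONLY (no definition, no instance, no notation, no named fact, no `sorry`).
Cell `pub/hodgecm-mathlib` (D-0151), crux H413 = `stmt-HodgeConjecture-24833`, road «W′»; consumer = B-p14 (g33)'s (B6-V) head `exists_wildValueLaws` (hypothesis `hdich`:
the NORM DICHOTOMY deciding which `K`-renormalised normal form `t` and its partner `e t` read), and (B6-O).  Tokens: `L⁺_v = v.adicCompletion L⁺`, `L_w`, `ι = toPlace v w`,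
`σ_w = galAdicCompletionMap c hw`, `θ = cmQuadraticGenerator L`, `κ(y) = (y, θ)_v = hilbertSymbol L⁺_v y θ`.  Dyadic places included.  HONEST LABEL: HC_CM is proved only
modulo the printed citations (hLiu418, h413) until rung 0 closes; local class-field bookkeeping only.

* §1 **`hilbertSymbol_eq_one_iff_exists_norm_toPlace (hy : y ≠ 0) : (y, θ)_v = 1 ↔ ∃ z : L_w, σ_w z * z = ι y`** (★ `exists_mul_conjLocal_eq_toLocalRing_iff` + ★
  `hilbertSymbol_eq_one_iff_mem_quadraticNormSubgroup`, `E_v = L_w` at a non-split place), `hilbertSymbol_eq_neg_one_iff_not_exists_norm_toPlace`.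
* §2 **`exists_norm_or_exists_norm_div_of_not_norm`**: `u_F ≠ 0` not a norm, `β ≠ 0` ⇒ `β ∈ N ∨ β∕u_F ∈ N`, exactly one (`hilbertSymbol_mul`, values `±1`); symbol readings.

## References
* [Omeara1963] O. T. O'Meara, *Introduction to Quadratic Forms* (1963): §63B (63:10–63:13a), §65A.
* [Labesse2024StabilisationGermesSL2] J.-P. Labesse, arXiv:2411.14820: Prop. 0.0.11 p. 8.  [LabesseLanglands1979] §2 pp. 8–9.
-/

set_option autoImplicit false

noncomputable section

open NumberField IsDedekindDomain

namespace Literature.NumberTheory.Rogawski1990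

open Literature.NumberTheory.Automorphic Literature.NumberTheory.Automorphic.UnitaryGroup Literature.NumberTheory.GaloisRepresentations
  Literature.NumberTheory.QuadraticForms

variable (L : Type) [Field L] [NumberField L] [IsCMField L] (v : HeightOneSpectrum (𝓞 ↥(maximalRealSubfield L)))
  (w : PlacesOver L v) (hw : IsCMField.complexConj L • w.1 = w.1)

/-- `θ = cmQuadraticGenerator L` is non-zero in `L⁺_v`. [folklore] -/
private theorem algebraMap_cmQuadraticGenerator_ne_zero' :
    (algebraMap ↥(maximalRealSubfield L) (v.adicCompletion ↥(maximalRealSubfield L)) ((cmQuadraticGenerator L : 𝓞 ↥(maximalRealSubfield L)) : ↥(maximalRealSubfield L))) ≠ 0 := by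
  rw [Ne, map_eq_zero_iff _ (algebraMap ↥(maximalRealSubfield L) (v.adicCompletion ↥(maximalRealSubfield L))).injective]
  exact fun h => not_isSquare_cmQuadraticGenerator L (by rw [h]; exact IsSquare.zero)

/-! ## §1 `(y, θ)_v = 1 ⟺ y is a norm from L_w` -/

include hw in
/-- **THE NORM READING**: for `y ≠ 0` in `L⁺_v` (non-split `v`), `(y, θ)_v = 1 ⟺ ∃ z ∈ L_w, σ_w z · z = ι_w y`. [cite: Omeara1963, §63B, §65A] -/
theorem hilbertSymbol_eq_one_iff_exists_norm_toPlace {y : v.adicCompletion ↥(maximalRealSubfield L)} (hy : y ≠ 0) :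
    hilbertSymbol (v.adicCompletion ↥(maximalRealSubfield L)) y
        (algebraMap ↥(maximalRealSubfield L) _ ((cmQuadraticGenerator L : 𝓞 ↥(maximalRealSubfield L)) : ↥(maximalRealSubfield L))) = 1 ↔
      ∃ z : w.1.adicCompletion L, galAdicCompletionMap (L := L) (IsCMField.complexConj L) hw z * z = toPlace v w y := by
  classical
  haveI : CharZero (v.adicCompletion ↥(maximalRealSubfield L)) :=
    charZero_of_injective_algebraMap (algebraMap ↥(maximalRealSubfield L) (v.adicCompletion ↥(maximalRealSubfield L))).injective
  haveI : NeZero (2 : v.adicCompletion ↥(maximalRealSubfield L)) := ⟨two_ne_zero⟩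
  haveI : Subsingleton (PlacesOver L v) := PlacesOver.subsingleton_of_smul_eq (IsCMField.complexConj L) (IsCMField.complexConj_ne_one L) w hw
  have hθ0 := algebraMap_cmQuadraticGenerator_ne_zero' L v
  have key := (hilbertSymbol_eq_one_iff_mem_quadraticNormSubgroup hθ0 (Units.mk0 y hy)).trans (exists_mul_conjLocal_eq_toLocalRing_iff (L := L) v (Units.mk0 y hy)).symm
  rw [Units.val_mk0] at key
  rw [key]
  constructor
  · rintro ⟨z, hz⟩
    refine ⟨z w, ?_⟩
    have h := congr_fun hz w
    rw [Pi.mul_apply, conjLocal_apply_eq_galAdicCompletionMap L v w hw, toLocalRing_apply] at h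
    rw [mul_comm]; exact h
  · rintro ⟨z, hz⟩
    refine ⟨@Pi.single (PlacesOver L v) (fun w' => w'.1.adicCompletion L) _ _ w z, funext fun w' => ?_⟩
    obtain rfl : w' = w := Subsingleton.elim _ _
    rw [Pi.mul_apply, conjLocal_apply_eq_galAdicCompletionMap L v w' hw, toLocalRing_apply, Pi.single_eq_same, mul_comm, hz]

include hw in
/-- **`(y, θ)_v = −1 ⟺ y is NOT a norm from `L_w`** (`y ≠ 0`). [cite: Omeara1963, §63B] -/
theorem hilbertSymbol_eq_neg_one_iff_not_exists_norm_toPlace {y : v.adicCompletion ↥(maximalRealSubfield L)} (hy : y ≠ 0) :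
    hilbertSymbol (v.adicCompletion ↥(maximalRealSubfield L)) y
        (algebraMap ↥(maximalRealSubfield L) _ ((cmQuadraticGenerator L : 𝓞 ↥(maximalRealSubfield L)) : ↥(maximalRealSubfield L))) = -1 ↔
      ¬ ∃ z : w.1.adicCompletion L, galAdicCompletionMap (L := L) (IsCMField.complexConj L) hw z * z = toPlace v w y := by
  rw [← hilbertSymbol_eq_one_iff_exists_norm_toPlace L v w hw hy]
  constructor
  · intro h h1; rw [h1] at h; norm_num at h
  · intro h
    rcases hilbertSymbol_eq_one_or_eq_neg_one y
      (algebraMap ↥(maximalRealSubfield L) _ ((cmQuadraticGenerator L : 𝓞 ↥(maximalRealSubfield L)) : ↥(maximalRealSubfield L))) with h1 | h1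
    · exact absurd h1 h
    · exact h1

/-! ## §2 The non-norm-unit dichotomy -/

include hw in
/-- **THE NORM DICHOTOMY**: if `u_F ≠ 0` is NOT a norm from `L_w` then for every `β ≠ 0` in `L⁺_v`, **`β` is a norm or `β∕u_F` is a norm** (`(β∕u_F, θ) = (β, θ)(u_F, θ)⁻¹ = −(β, θ)`
and symbols are `±1`). [cite: Omeara1963, §63B (63:13a)] [cite: Labesse2024StabilisationGermesSL2, Prop. 0.0.11] -/
theorem exists_norm_or_exists_norm_div_of_not_norm {uF β : v.adicCompletion ↥(maximalRealSubfield L)} (hu0 : uF ≠ 0)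
    (hun : ¬ ∃ z : w.1.adicCompletion L, galAdicCompletionMap (L := L) (IsCMField.complexConj L) hw z * z = toPlace v w uF) (hβ : β ≠ 0) :
    (∃ z : w.1.adicCompletion L, galAdicCompletionMap (L := L) (IsCMField.complexConj L) hw z * z = toPlace v w β) ∨
      (∃ z : w.1.adicCompletion L, galAdicCompletionMap (L := L) (IsCMField.complexConj L) hw z * z = toPlace v w (β / uF)) := by
  haveI : CharZero (v.adicCompletion ↥(maximalRealSubfield L)) :=
    charZero_of_injective_algebraMap (algebraMap ↥(maximalRealSubfield L) (v.adicCompletion ↥(maximalRealSubfield L))).injective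
  set θ : v.adicCompletion ↥(maximalRealSubfield L) :=
    algebraMap ↥(maximalRealSubfield L) _ ((cmQuadraticGenerator L : 𝓞 ↥(maximalRealSubfield L)) : ↥(maximalRealSubfield L)) with hθ
  have hθ0 : θ ≠ 0 := algebraMap_cmQuadraticGenerator_ne_zero' L v
  have hu : hilbertSymbol _ uF θ = -1 := (hilbertSymbol_eq_neg_one_iff_not_exists_norm_toPlace L v w hw hu0).2 hun
  rw [← hilbertSymbol_eq_one_iff_exists_norm_toPlace L v w hw hβ, ← hilbertSymbol_eq_one_iff_exists_norm_toPlace L v w hw (div_ne_zero hβ hu0),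
    div_eq_mul_inv, hilbertSymbol_adicCompletion_mul_left ↥(maximalRealSubfield L) v hβ (inv_ne_zero hu0) hθ0, hilbertSymbol_inv_left hu0, hu]
  rcases hilbertSymbol_eq_one_or_eq_neg_one β θ with h | h
  · exact Or.inl h
  · right; rw [h]; norm_num

include hw in
/-- **Exactly one**: with `u_F` not a norm, `β` and `β∕u_F` are never BOTH norms. [cite: Omeara1963, §63B (63:13a)] -/
theorem not_exists_norm_and_exists_norm_div_of_not_norm {uF β : v.adicCompletion ↥(maximalRealSubfield L)} (hu0 : uF ≠ 0)
    (hun : ¬ ∃ z : w.1.adicCompletion L, galAdicCompletionMap (L := L) (IsCMField.complexConj L) hw z * z = toPlace v w uF) (hβ : β ≠ 0) :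
    ¬ ((∃ z : w.1.adicCompletion L, galAdicCompletionMap (L := L) (IsCMField.complexConj L) hw z * z = toPlace v w β) ∧
      (∃ z : w.1.adicCompletion L, galAdicCompletionMap (L := L) (IsCMField.complexConj L) hw z * z = toPlace v w (β / uF))) := by
  haveI : CharZero (v.adicCompletion ↥(maximalRealSubfield L)) :=
    charZero_of_injective_algebraMap (algebraMap ↥(maximalRealSubfield L) (v.adicCompletion ↥(maximalRealSubfield L))).injective
  set θ : v.adicCompletion ↥(maximalRealSubfield L) :=
    algebraMap ↥(maximalRealSubfield L) _ ((cmQuadraticGenerator L : 𝓞 ↥(maximalRealSubfield L)) : ↥(maximalRealSubfield L)) with hθ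
  have hθ0 : θ ≠ 0 := algebraMap_cmQuadraticGenerator_ne_zero' L v
  have hu : hilbertSymbol _ uF θ = -1 := (hilbertSymbol_eq_neg_one_iff_not_exists_norm_toPlace L v w hw hu0).2 hun
  rw [← hilbertSymbol_eq_one_iff_exists_norm_toPlace L v w hw hβ, ← hilbertSymbol_eq_one_iff_exists_norm_toPlace L v w hw (div_ne_zero hβ hu0),
    div_eq_mul_inv, hilbertSymbol_adicCompletion_mul_left ↥(maximalRealSubfield L) v hβ (inv_ne_zero hu0) hθ0, hilbertSymbol_inv_left hu0, hu]
  rintro ⟨h1, h2⟩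
  rw [h1] at h2; norm_num at h2

/-- Symbol reading of the dichotomy: `(u_F, θ)_v = −1` and `β ≠ 0` ⇒ `(β, θ)_v = 1 ∨ (β∕u_F, θ)_v = 1`, and `(β∕u_F, θ)_v = −(β, θ)_v`.
[cite: Omeara1963, §63B (63:13a)] -/
theorem hilbertSymbol_div_eq_neg_of_eq_neg_one {uF β : v.adicCompletion ↥(maximalRealSubfield L)} (hu0 : uF ≠ 0) (hβ : β ≠ 0)
    (hu : hilbertSymbol (v.adicCompletion ↥(maximalRealSubfield L)) uF
      (algebraMap ↥(maximalRealSubfield L) _ ((cmQuadraticGenerator L : 𝓞 ↥(maximalRealSubfield L)) : ↥(maximalRealSubfield L))) = -1) :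
    hilbertSymbol (v.adicCompletion ↥(maximalRealSubfield L)) (β / uF)
        (algebraMap ↥(maximalRealSubfield L) _ ((cmQuadraticGenerator L : 𝓞 ↥(maximalRealSubfield L)) : ↥(maximalRealSubfield L))) =
      -hilbertSymbol (v.adicCompletion ↥(maximalRealSubfield L)) β
        (algebraMap ↥(maximalRealSubfield L) _ ((cmQuadraticGenerator L : 𝓞 ↥(maximalRealSubfield L)) : ↥(maximalRealSubfield L))) := by
  haveI : CharZero (v.adicCompletion ↥(maximalRealSubfield L)) :=
    charZero_of_injective_algebraMap (algebraMap ↥(maximalRealSubfield L) (v.adicCompletion ↥(maximalRealSubfield L))).injective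
  have hθ0 := algebraMap_cmQuadraticGenerator_ne_zero' L v
  rw [div_eq_mul_inv, hilbertSymbol_adicCompletion_mul_left ↥(maximalRealSubfield L) v hβ (inv_ne_zero hu0) hθ0, hilbertSymbol_inv_left hu0, hu]
  ring

end Literature.NumberTheory.Rogawski1990

end
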